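import Mathlib

/-!
# k1-g28 (stub-ideation `stub_cmLambdaLower`, technique «weaken / strengthen») — the FRAME LEDGER behind station (R)

Pure commutative algebra, Mathlib only: 0 `def` / `instance` / `notation`, no placeholders.  Conventions are those of the landed
`…Theorems.ThetaTransport.PriceNode` (p714652): `A : 𝒪 →+* Matrix (Fin n) (Fin n) R` is the local-Schur matrix of `Θ ∘ [a] ∘ Θ⁻¹`
(Σ_bal), `Φ : 𝒪 ≃+ (Fin n → R)` is `A`-equivariant (`Φ (a * b) = (A a) *ᵥ Φ b`), `ι : R →+* 𝒪`, `t₀ : 𝒪 →+ R` is the pins' trace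
functional (`R`-linear), `c' : Fin n → 𝒪` is child A's Kato coordinate vector (`KatoBKCoord`: the BK coefficient of coordinate `i`
is `t₀ (c' i * a * bO j)`), and `e : (Fin n → R⟦X⟧) ≃+ 𝒪⟦X⟧` is a trivialisation (station (E)).

* §1 FRAME `c' i * a = ∑ k, ι (A a i k) * c' k` ⟺ the `c'`-recombination `x ↦ Φ⁻¹ (t₀ (c' i * x))_i` is `𝒪`-linear; then it is
  `x ↦ x * ν`, `ν = Φ⁻¹ (t₀ (c' i))_i`, and `ν ≠ 0` under child A's `CoordNondeg`.
* §2 Semilinear + GLOBALLY admissible trivialisations are explicit: `e t = F t * W`, `W = e (C (Φ 1 i))_i` a UNIT; two of them differ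
  by a unit (TORSOR); admissibility on `𝒸 (span {z})` (the (E) clause) + saturation ⟹ global admissibility.
* §3 The recombination identity the (R) supplier needs — `e (C (t₀ (c' i * x)))_i = C (x * ν) * W` — holds under FRAME, and
  conversely forces FRAME: the frame property of `c'` is EXACTLY the hypothesis of the recombination step.

BSD, `RSL_g` (22608), `KZ_g` (24105), `(R≥)ᵖ` (26074) and station (R) are NOT proved by any of this.
-/

namespace Summit.BirchSwinnertonDyer.BirchSwinnertonDyer.Cruxes.ResidualThetaCountLowerPureAtTwo.SideaK1G28

open Finset

/-! ## §1 FRAME ⟺ `𝒪`-linearity of the `c'`-recombination; the constant `ν` -/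

section Frame

variable {R : Type*} [CommRing R] {𝒪 : Type*} [CommRing 𝒪] {n : ℕ}

/-- **(F1)** Under FRAME and `R`-linearity of `t₀`, the coordinate map `T x := (t₀ (c' i * x))_i` is `A`-equivariant:
`T (a * x) = (A a) *ᵥ T x`. [cite: Kato2004Asterisque, §13.8 (pp. 228–229)] -/
theorem coords_mul_eq_mulVec_of_frame (ι : R →+* 𝒪) (A : 𝒪 →+* Matrix (Fin n) (Fin n) R) (t₀ : 𝒪 →+ R)
    (ht₀ : ∀ (c : R) (x : 𝒪), t₀ (ι c * x) = c * t₀ x) (c' : Fin n → 𝒪)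
    (hfr : ∀ (a : 𝒪) (i : Fin n), c' i * a = ∑ k, ι (A a i k) * c' k) (a x : 𝒪) :
    (fun i => t₀ (c' i * (a * x))) = (A a).mulVec fun k => t₀ (c' k * x) := by
  funext i
  rw [Matrix.mulVec, dotProduct, ← mul_assoc, hfr, Finset.sum_mul, map_sum]
  exact Finset.sum_congr rfl fun k _ => by rw [mul_assoc, ht₀]

/-- **(F2)** FRAME ⟹ the `c'`-coordinates of `x` are the `Φ`-coordinates of `x * ν`, `ν := Φ⁻¹ (t₀ (c' i))_i`.
[cite: Kato2004Asterisque, §13.8 (pp. 228–229)] -/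
theorem coords_eq_equivariant_of_frame (ι : R →+* 𝒪) (A : 𝒪 →+* Matrix (Fin n) (Fin n) R) (t₀ : 𝒪 →+ R)
    (ht₀ : ∀ (c : R) (x : 𝒪), t₀ (ι c * x) = c * t₀ x) (c' : Fin n → 𝒪)
    (hfr : ∀ (a : 𝒪) (i : Fin n), c' i * a = ∑ k, ι (A a i k) * c' k)
    (Φ : 𝒪 ≃+ (Fin n → R)) (hΦA : ∀ a b : 𝒪, Φ (a * b) = (A a).mulVec (Φ b)) (x : 𝒪) :
    (fun i => t₀ (c' i * x)) = Φ (x * Φ.symm fun i => t₀ (c' i)) := by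
  rw [hΦA, AddEquiv.apply_symm_apply]
  have h := coords_mul_eq_mulVec_of_frame ι A t₀ ht₀ c' hfr x 1
  simp only [mul_one] at h
  exact h

/-- **(F3)** FRAME ⟹ the recombination functional `L x := Φ⁻¹ (t₀ (c' i * x))_i` IS multiplication by the constant `ν`.
[cite: Kato2004Asterisque, §13.8 (pp. 228–229)] -/
theorem recombination_eq_mul_of_frame (ι : R →+* 𝒪) (A : 𝒪 →+* Matrix (Fin n) (Fin n) R) (t₀ : 𝒪 →+ R)
    (ht₀ : ∀ (c : R) (x : 𝒪), t₀ (ι c * x) = c * t₀ x) (c' : Fin n → 𝒪)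
    (hfr : ∀ (a : 𝒪) (i : Fin n), c' i * a = ∑ k, ι (A a i k) * c' k)
    (Φ : 𝒪 ≃+ (Fin n → R)) (hΦA : ∀ a b : 𝒪, Φ (a * b) = (A a).mulVec (Φ b)) (x : 𝒪) :
    Φ.symm (fun i => t₀ (c' i * x)) = x * Φ.symm fun i => t₀ (c' i) := by
  rw [coords_eq_equivariant_of_frame ι A t₀ ht₀ c' hfr Φ hΦA x, AddEquiv.symm_apply_apply]

/-- **(F4) FRAME IS NECESSARY.** If the recombination is `𝒪`-linear (`L x = x * ν` for some `ν`) and `t₀` is `R`-linear and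
nondegenerate, then `c'` is a FRAME. [cite: Kato2004Asterisque, §13.8 (pp. 228–229)] -/
theorem frame_of_recombination_eq_mul (ι : R →+* 𝒪) (A : 𝒪 →+* Matrix (Fin n) (Fin n) R) (t₀ : 𝒪 →+ R)
    (ht₀ : ∀ (c : R) (x : 𝒪), t₀ (ι c * x) = c * t₀ x) (hnd : ∀ y : 𝒪, (∀ x : 𝒪, t₀ (y * x) = 0) → y = 0)
    (c' : Fin n → 𝒪) (Φ : 𝒪 ≃+ (Fin n → R)) (hΦA : ∀ a b : 𝒪, Φ (a * b) = (A a).mulVec (Φ b)) (ν : 𝒪)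
    (hν : ∀ x : 𝒪, Φ.symm (fun i => t₀ (c' i * x)) = x * ν) (a : 𝒪) (i : Fin n) :
    c' i * a = ∑ k, ι (A a i k) * c' k := by
  have hT : ∀ x : 𝒪, (fun i => t₀ (c' i * x)) = Φ (x * ν) := fun x => by
    rw [← hν, AddEquiv.apply_symm_apply]
  rw [← sub_eq_zero]
  refine hnd _ fun x => ?_
  rw [sub_mul, map_sub, sub_eq_zero, Finset.sum_mul, map_sum]
  calc t₀ (c' i * a * x) = Φ (a * x * ν) i := by rw [mul_assoc]; exact congrFun (hT (a * x)) i
    _ = ((A a).mulVec (Φ (x * ν))) i := by rw [mul_assoc, hΦA]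
    _ = ∑ k, A a i k * t₀ (c' k * x) := by rw [Matrix.mulVec, dotProduct, ← hT x]
    _ = ∑ k, t₀ (ι (A a i k) * c' k * x) := Finset.sum_congr rfl fun k _ => by rw [mul_assoc, ht₀]

/-- **(F5)** Child A's `CoordNondeg` (injectivity of `x ↦ (t₀ (c' i * x))_i`) ⟹ `ν ≠ 0`.
[cite: Kato2004Asterisque, Thm. 12.5 (1) (pp. 221–222)] -/
theorem nu_ne_zero_of_injective [Nontrivial 𝒪] (t₀ : 𝒪 →+ R) (c' : Fin n → 𝒪)
    (hinj : Function.Injective fun (x : 𝒪) (i : Fin n) => t₀ (c' i * x)) (Φ : 𝒪 ≃+ (Fin n → R)) :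
    Φ.symm (fun i => t₀ (c' i)) ≠ 0 := by
  intro h
  have h1 : (fun i => t₀ (c' i * 1)) = fun i => t₀ (c' i * 0) := by
    funext i
    rw [mul_one, mul_zero, map_zero]
    have h2 := congrFun (congrArg Φ h) i
    rw [AddEquiv.apply_symm_apply, map_zero, Pi.zero_apply] at h2
    exact h2
  exact one_ne_zero (hinj h1)

/-- **(F6)** Where an INDEPENDENCE input would enter (documentation of the gap): a vanishing combination
`∑ j, t₀ (D * b j) • V j = 0` with `(V j)` linearly independent and `(b j)` `t₀`-separating forces the frame defect `D = 0`.
[cite: Kato2004Asterisque, Thm. 12.5 (1) (pp. 221–222)] -/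
theorem frameDefect_eq_zero_of_linearIndependent {M : Type*} [AddCommGroup M] [Module R M] {m : ℕ} (t₀ : 𝒪 →+ R)
    (b : Fin m → 𝒪) (hb : ∀ y : 𝒪, (∀ j, t₀ (y * b j) = 0) → y = 0) (V : Fin m → M) (hV : LinearIndependent R V)
    (D : 𝒪) (h : ∑ j, t₀ (D * b j) • V j = 0) : D = 0 :=
  hb D (Fintype.linearIndependent_iff.1 hV _ h)

/-- **(F7) matrix FRAME ⟹ the `Θ`-form (FRAMEρ), matrix-free**: along a coordinatisation `Θ : M ≃+ (Fin n → T)` on which `𝒪` acts through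
`A` (Σ_bal: `Θ (a • m) i = ∑ j, A a i j • Θ m j`), the `c'`-coordinate vector of `a * x`, placed on any `w₀ ∈ T`, is `a •` that of `x`:
`Θ⁻¹ ((t₀ (c' i * (a * x)) • w₀)_i) = a • Θ⁻¹ ((t₀ (c' i * x) • w₀)_i)` — a one-line clause over `Θ`, `t₀`, `c'` only.
[cite: Kato2004Asterisque, §13.8 (pp. 228–229)] -/
theorem theta_symm_coords_mul_of_frame {T : Type*} [AddCommGroup T] [Module R T] {M : Type*} [AddCommGroup M] [Module 𝒪 M]
    (ι : R →+* 𝒪) (A : 𝒪 →+* Matrix (Fin n) (Fin n) R) (t₀ : 𝒪 →+ R)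
    (ht₀ : ∀ (c : R) (x : 𝒪), t₀ (ι c * x) = c * t₀ x) (c' : Fin n → 𝒪)
    (hfr : ∀ (a : 𝒪) (i : Fin n), c' i * a = ∑ k, ι (A a i k) * c' k)
    (Θ : M ≃+ (Fin n → T)) (hΘA : ∀ (a : 𝒪) (m : M) (i : Fin n), Θ (a • m) i = ∑ j, A a i j • Θ m j)
    (w₀ : T) (a x : 𝒪) :
    Θ.symm (fun i => t₀ (c' i * (a * x)) • w₀) = a • Θ.symm (fun i => t₀ (c' i * x) • w₀) := by
  apply Θ.injective
  funext i
  have h1 := congrFun (coords_mul_eq_mulVec_of_frame ι A t₀ ht₀ c' hfr a x) i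
  simp only [AddEquiv.apply_symm_apply, hΘA]
  rw [h1, Matrix.mulVec, dotProduct, Finset.sum_smul]
  exact Finset.sum_congr rfl fun j _ => by rw [mul_smul]

/-- **(F8) Conversely, the `Θ`-form (FRAMEρ) ⟹ matrix FRAME** when the scalars act faithfully on `T` and `t₀` is nondegenerate: so (F7)'s
matrix-free clause is an EQUIVALENT typing of the frame property. [cite: Kato2004Asterisque, §13.8 (pp. 228–229)] -/
theorem frame_of_theta_symm_coords_mul {T : Type*} [AddCommGroup T] [Module R T] {M : Type*} [AddCommGroup M] [Module 𝒪 M]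
    (ι : R →+* 𝒪) (A : 𝒪 →+* Matrix (Fin n) (Fin n) R) (t₀ : 𝒪 →+ R)
    (ht₀ : ∀ (c : R) (x : 𝒪), t₀ (ι c * x) = c * t₀ x) (hnd : ∀ y : 𝒪, (∀ x : 𝒪, t₀ (y * x) = 0) → y = 0)
    (c' : Fin n → 𝒪) (Θ : M ≃+ (Fin n → T)) (hΘA : ∀ (a : 𝒪) (m : M) (i : Fin n), Θ (a • m) i = ∑ j, A a i j • Θ m j)
    (hfaith : ∀ c : R, (∀ w₀ : T, c • w₀ = 0) → c = 0)
    (h : ∀ (w₀ : T) (a x : 𝒪), Θ.symm (fun i => t₀ (c' i * (a * x)) • w₀) = a • Θ.symm (fun i => t₀ (c' i * x) • w₀))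
    (a : 𝒪) (i : Fin n) : c' i * a = ∑ k, ι (A a i k) * c' k := by
  have key : ∀ x : 𝒪, t₀ (c' i * (a * x)) = ∑ k, A a i k * t₀ (c' k * x) := fun x => by
    rw [← sub_eq_zero]
    refine hfaith _ fun w₀ => ?_
    have hw := congrFun (congrArg Θ (h w₀ a x)) i
    simp only [AddEquiv.apply_symm_apply, hΘA] at hw
    rw [sub_smul, hw, Finset.sum_smul, sub_eq_zero]
    exact Finset.sum_congr rfl fun j _ => by rw [mul_smul]
  rw [← sub_eq_zero]
  refine hnd _ fun x => ?_
  rw [sub_mul, map_sub, sub_eq_zero, Finset.sum_mul, map_sum]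
  calc t₀ (c' i * a * x) = ∑ k, A a i k * t₀ (c' k * x) := by rw [mul_assoc]; exact key x
    _ = ∑ k, t₀ (ι (A a i k) * c' k * x) := Finset.sum_congr rfl fun k _ => by rw [mul_assoc, ht₀]

end Frame

/-! ## §2 Globally admissible trivialisations: explicit up to a unit; the torsor; local ⟹ global -/

section Torsor

variable {R : Type*} [CommRing R] {𝒪 : Type*} [CommRing 𝒪] {n : ℕ}

/-- **(T0)** A `Λ`-semilinear `e` is determined by the images of the basis vectors:
`e t = ∑ i, map ι (t i) * e (single i 1)`. [cite: Washington1997, §13.2] -/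
theorem apply_eq_sum_map_mul (ι : R →+* 𝒪) (e : (Fin n → PowerSeries R) ≃+ PowerSeries 𝒪)
    (he : ∀ (r : PowerSeries R) (t : Fin n → PowerSeries R), e (r • t) = PowerSeries.map ι r * e t)
    (t : Fin n → PowerSeries R) :
    e t = ∑ i, PowerSeries.map ι (t i) * e (Pi.single i 1) := by
  have ht : t = ∑ i, t i • (Pi.single i (1 : PowerSeries R) : Fin n → PowerSeries R) := by
    conv_lhs => rw [← Finset.univ_sum_single t]
    refine Finset.sum_congr rfl fun i _ => ?_
    funext j
    by_cases h : j = i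
    · subst h; simp
    · simp [h]
  conv_lhs => rw [ht]
  rw [map_sum]
  exact Finset.sum_congr rfl fun i _ => he _ _

/-- **(T1)** A GLOBALLY admissible `e` (`e (A a ⋆ t) = C a * e t` for all `t`) is `𝒪`-linear on the `Φ`-coordinate vectors of
constants: `e (C (Φ (a * b) i))_i = C a * e (C (Φ b i))_i`. [cite: Kato2004Asterisque, §13.8 (p. 228)] -/
theorem apply_constCoords_mul (A : 𝒪 →+* Matrix (Fin n) (Fin n) R) (Φ : 𝒪 ≃+ (Fin n → R))
    (hΦA : ∀ a b : 𝒪, Φ (a * b) = (A a).mulVec (Φ b)) (e : (Fin n → PowerSeries R) ≃+ PowerSeries 𝒪)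
    (hA : ∀ (a : 𝒪) (t : Fin n → PowerSeries R),
      e (fun i => ∑ j, (PowerSeries.C (A a i j) : PowerSeries R) * t j) = (PowerSeries.C a : PowerSeries 𝒪) * e t)
    (a b : 𝒪) :
    e (fun i => (PowerSeries.C (Φ (a * b) i) : PowerSeries R)) =
      (PowerSeries.C a : PowerSeries 𝒪) * e fun i => (PowerSeries.C (Φ b i) : PowerSeries R) := by
  rw [← hA]
  congr 1
  funext i
  rw [hΦA, Matrix.mulVec, dotProduct, map_sum]
  exact Finset.sum_congr rfl fun j _ => by rw [map_mul]

/-- **(T2)** Hence a semilinear, globally admissible `e` is EXPLICIT up to the single element `W := e (C (Φ 1 i))_i`: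
`e t = (∑ i, map ι (t i) * C (Φ⁻¹ (single i 1))) * W` (the bracket is the coefficientwise trivialisation of `PriceNode`).
[cite: Washington1997, §13.2] [cite: Kato2004Asterisque, §13.8 (p. 228)] -/
theorem apply_eq_explicit_mul (ι : R →+* 𝒪) (A : 𝒪 →+* Matrix (Fin n) (Fin n) R) (Φ : 𝒪 ≃+ (Fin n → R))
    (hΦA : ∀ a b : 𝒪, Φ (a * b) = (A a).mulVec (Φ b)) (e : (Fin n → PowerSeries R) ≃+ PowerSeries 𝒪)
    (he : ∀ (r : PowerSeries R) (t : Fin n → PowerSeries R), e (r • t) = PowerSeries.map ι r * e t)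
    (hA : ∀ (a : 𝒪) (t : Fin n → PowerSeries R),
      e (fun i => ∑ j, (PowerSeries.C (A a i j) : PowerSeries R) * t j) = (PowerSeries.C a : PowerSeries 𝒪) * e t)
    (t : Fin n → PowerSeries R) :
    e t = (∑ i, PowerSeries.map ι (t i) * (PowerSeries.C (Φ.symm (Pi.single i 1)) : PowerSeries 𝒪)) *
      e fun i => (PowerSeries.C (Φ 1 i) : PowerSeries R) := by
  rw [apply_eq_sum_map_mul ι e he t, Finset.sum_mul]
  refine Finset.sum_congr rfl fun i _ => ?_
  rw [mul_assoc, ← apply_constCoords_mul A Φ hΦA e hA]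
  simp only [mul_one, AddEquiv.apply_symm_apply]
  congr 2
  funext j
  rw [Pi.single_apply, Pi.single_apply]
  split_ifs <;> simp

/-- **(T3)** `W = e (C (Φ 1 i))_i` is a UNIT of `𝒪⟦X⟧`. [cite: Washington1997, §13.2] -/
theorem isUnit_apply_constCoords_one (ι : R →+* 𝒪) (A : 𝒪 →+* Matrix (Fin n) (Fin n) R) (Φ : 𝒪 ≃+ (Fin n → R))
    (hΦA : ∀ a b : 𝒪, Φ (a * b) = (A a).mulVec (Φ b)) (e : (Fin n → PowerSeries R) ≃+ PowerSeries 𝒪)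
    (he : ∀ (r : PowerSeries R) (t : Fin n → PowerSeries R), e (r • t) = PowerSeries.map ι r * e t)
    (hA : ∀ (a : 𝒪) (t : Fin n → PowerSeries R),
      e (fun i => ∑ j, (PowerSeries.C (A a i j) : PowerSeries R) * t j) = (PowerSeries.C a : PowerSeries 𝒪) * e t) :
    IsUnit (e fun i => (PowerSeries.C (Φ 1 i) : PowerSeries R)) := by
  obtain ⟨t, ht⟩ := e.surjective 1
  rw [apply_eq_explicit_mul ι A Φ hΦA e he hA t] at ht
  exact IsUnit.of_mul_eq_one _ (by rwa [mul_comm] at ht)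

/-- **(T4) TORSOR.** Two semilinear, globally admissible trivialisations differ by a unit: `e' t = w * e t` for all `t`.
So any statement about `e (𝒸 z)` up to units (station (R): `C ν * e (𝒸 z) = μ̃ * (L⁻ * u)`) for ONE such `e` gives it for ALL.
[cite: Washington1997, §13.2] [cite: Kato2004Asterisque, §13.8 (p. 228)] -/
theorem exists_unit_mul_of_admissible (ι : R →+* 𝒪) (A : 𝒪 →+* Matrix (Fin n) (Fin n) R) (Φ : 𝒪 ≃+ (Fin n → R))
    (hΦA : ∀ a b : 𝒪, Φ (a * b) = (A a).mulVec (Φ b)) (e e' : (Fin n → PowerSeries R) ≃+ PowerSeries 𝒪)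
    (he : ∀ (r : PowerSeries R) (t : Fin n → PowerSeries R), e (r • t) = PowerSeries.map ι r * e t)
    (hA : ∀ (a : 𝒪) (t : Fin n → PowerSeries R),
      e (fun i => ∑ j, (PowerSeries.C (A a i j) : PowerSeries R) * t j) = (PowerSeries.C a : PowerSeries 𝒪) * e t)
    (he' : ∀ (r : PowerSeries R) (t : Fin n → PowerSeries R), e' (r • t) = PowerSeries.map ι r * e' t)
    (hA' : ∀ (a : 𝒪) (t : Fin n → PowerSeries R),
      e' (fun i => ∑ j, (PowerSeries.C (A a i j) : PowerSeries R) * t j) = (PowerSeries.C a : PowerSeries 𝒪) * e' t) :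
    ∃ w : (PowerSeries 𝒪)ˣ, ∀ t, e' t = w * e t := by
  obtain ⟨W, hW⟩ := isUnit_apply_constCoords_one ι A Φ hΦA e he hA
  obtain ⟨W', hW'⟩ := isUnit_apply_constCoords_one ι A Φ hΦA e' he' hA'
  refine ⟨W' * W⁻¹, fun t => ?_⟩
  have h : e' t * ↑W = e t * ↑W' := by
    rw [apply_eq_explicit_mul ι A Φ hΦA e' he' hA' t, apply_eq_explicit_mul ι A Φ hΦA e he hA t, ← hW, ← hW']
    ring
  calc e' t = e' t * ↑W * ↑W⁻¹ := (Units.mul_inv_cancel_right _ _).symm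
    _ = ↑(W' * W⁻¹) * e t := by rw [h, Units.val_mul]; ring

/-- **(T5) LOCAL ⟹ GLOBAL admissibility on the saturation.** If `e ∘ 𝒸` is `Λ_𝒪`-linear on a `Λ_𝒪`-submodule `S` (the (E)
clause on `span {z}`), `𝒸` carries `C a •` to `A a ⋆` on `S` (Σ_bal / H9), and `r • t = 𝒸 x` for some `r ≠ 0`, `x ∈ S`
(`t` in the saturation of `𝒸 S`), then `e (A a ⋆ t) = C a * e t` (`𝒪` a domain, `ι` injective).
[cite: Kato2004Asterisque, §13.8 (pp. 228–229)] [cite: Washington1997, §13.2] -/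
theorem matrixSMul_of_linear_on_submodule [IsDomain 𝒪] (ι : R →+* 𝒪) (hι : Function.Injective ι)
    {H : Type*} [AddCommGroup H] [Module (PowerSeries 𝒪) H] (𝒸 : H →+ (Fin n → PowerSeries R))
    (S : Submodule (PowerSeries 𝒪) H) (A : 𝒪 →+* Matrix (Fin n) (Fin n) R)
    (hO : ∀ (a : 𝒪), ∀ x ∈ S, 𝒸 ((PowerSeries.C a : PowerSeries 𝒪) • x) =
      fun i => ∑ j, (PowerSeries.C (A a i j) : PowerSeries R) * 𝒸 x j)
    (e : (Fin n → PowerSeries R) ≃+ PowerSeries 𝒪)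
    (he : ∀ (r : PowerSeries R) (t : Fin n → PowerSeries R), e (r • t) = PowerSeries.map ι r * e t)
    (hlin : ∀ (s : PowerSeries 𝒪), ∀ x ∈ S, e (𝒸 (s • x)) = s * e (𝒸 x))
    (t : Fin n → PowerSeries R) (r : PowerSeries R) (hr : r ≠ 0) (x : H) (hx : x ∈ S) (hrt : r • t = 𝒸 x) (a : 𝒪) :
    e (fun i => ∑ j, (PowerSeries.C (A a i j) : PowerSeries R) * t j) = (PowerSeries.C a : PowerSeries 𝒪) * e t := by
  have hmap : PowerSeries.map ι r ≠ 0 := by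
    intro h
    apply hr
    ext m
    have hm := congrArg (PowerSeries.coeff m) h
    rw [PowerSeries.coeff_map, map_zero] at hm
    rw [map_zero]
    exact hι (by rw [hm, map_zero])
  apply mul_left_cancel₀ hmap
  rw [← he, mul_left_comm, ← he, hrt, ← hlin (PowerSeries.C a) x hx, hO a x hx, ← hrt]
  congr 1
  funext i
  rw [Pi.smul_apply, smul_eq_mul, Finset.mul_sum]
  exact Finset.sum_congr rfl fun j _ => by rw [Pi.smul_apply, smul_eq_mul, mul_left_comm]

/-- **(T6) SATURATION from one column.** If `e₀` is admissible on `S ∋ z` and `E₀ := e₀ (𝒸 z)` divides an element of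
`Λ₀ = map ι (R⟦X⟧)` (`E' * E₀ = map ι r`, e.g. `r` = its norm), then `r • t ∈ 𝒸 S` for every `t`.
[cite: Washington1997, §13.2] -/
theorem exists_smul_eq_of_dvd_map (ι : R →+* 𝒪) {H : Type*} [AddCommGroup H] [Module (PowerSeries 𝒪) H]
    (𝒸 : H →+ (Fin n → PowerSeries R)) (S : Submodule (PowerSeries 𝒪) H) (z : H) (hz : z ∈ S)
    (e₀ : (Fin n → PowerSeries R) ≃+ PowerSeries 𝒪)
    (he₀ : ∀ (r : PowerSeries R) (t : Fin n → PowerSeries R), e₀ (r • t) = PowerSeries.map ι r * e₀ t)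
    (hlin₀ : ∀ (s : PowerSeries 𝒪), ∀ x ∈ S, e₀ (𝒸 (s • x)) = s * e₀ (𝒸 x))
    (E' : PowerSeries 𝒪) (r : PowerSeries R) (hE : E' * e₀ (𝒸 z) = PowerSeries.map ι r) (t : Fin n → PowerSeries R) :
    ∃ x ∈ S, r • t = 𝒸 x := by
  refine ⟨(E' * e₀ t) • z, S.smul_mem _ hz, e₀.injective ?_⟩
  rw [he₀, hlin₀ _ z hz, ← hE]
  ring

end Torsor

/-! ## §3 The recombination identity of station (R), and its converse -/

section Recombination

variable {R : Type*} [CommRing R] {𝒪 : Type*} [CommRing 𝒪] {n : ℕ}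

/-- **(V1) THE RECOMBINATION IDENTITY.** FRAME + `t₀` `R`-linear + `e` globally admissible ⟹
`e (C (t₀ (c' i * x)))_i = C (x * ν) * W`, `ν = Φ⁻¹ (t₀ (c' i))_i`, `W = e (C (Φ 1 i))_i`. With `x = a * bO j` this is the step that
turns child A's BK coefficients `t₀ (c' i * a * bO j)` into `𝒪`-CONSTANTS `a * bO j * ν` outside the Galois sums.
[cite: Kato2004Asterisque, Thm. 12.5 (1) (pp. 221–222), §13.8 (p. 228)] [cite: Kobayashi2003, Prop. 8.25, Lem. 8.26] -/
theorem apply_coords_eq_of_frame (ι : R →+* 𝒪) (A : 𝒪 →+* Matrix (Fin n) (Fin n) R) (t₀ : 𝒪 →+ R)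
    (ht₀ : ∀ (c : R) (x : 𝒪), t₀ (ι c * x) = c * t₀ x) (c' : Fin n → 𝒪)
    (hfr : ∀ (a : 𝒪) (i : Fin n), c' i * a = ∑ k, ι (A a i k) * c' k)
    (Φ : 𝒪 ≃+ (Fin n → R)) (hΦA : ∀ a b : 𝒪, Φ (a * b) = (A a).mulVec (Φ b))
    (e : (Fin n → PowerSeries R) ≃+ PowerSeries 𝒪)
    (hA : ∀ (a : 𝒪) (t : Fin n → PowerSeries R),
      e (fun i => ∑ j, (PowerSeries.C (A a i j) : PowerSeries R) * t j) = (PowerSeries.C a : PowerSeries 𝒪) * e t)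
    (x : 𝒪) :
    e (fun i => (PowerSeries.C (t₀ (c' i * x)) : PowerSeries R)) =
      (PowerSeries.C (x * Φ.symm fun i => t₀ (c' i)) : PowerSeries 𝒪) * e fun i => (PowerSeries.C (Φ 1 i) : PowerSeries R) := by
  rw [← apply_constCoords_mul A Φ hΦA e hA]
  simp only [mul_one]
  congr 1
  funext i
  exact congrArg (fun y : R => (PowerSeries.C y : PowerSeries R))
    (congrFun (coords_eq_equivariant_of_frame ι A t₀ ht₀ c' hfr Φ hΦA x) i)

/-- **(V2) Summary for the (R) supplier.** Under FRAME, `CoordNondeg`, semilinearity and global admissibility: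
`∃ ν ≠ 0, ∃ W unit, ∀ x, e (C (t₀ (c' i * x)))_i = C (x * ν) * W` — the provenance of the constant `C ν` and of the unit in station (R).
[cite: Kato2004Asterisque, Thm. 12.5 (1) (pp. 221–222), §13.8 (p. 228)] -/
theorem exists_nu_unit_recombination [Nontrivial 𝒪] (ι : R →+* 𝒪) (A : 𝒪 →+* Matrix (Fin n) (Fin n) R) (t₀ : 𝒪 →+ R)
    (ht₀ : ∀ (c : R) (x : 𝒪), t₀ (ι c * x) = c * t₀ x) (c' : Fin n → 𝒪)
    (hfr : ∀ (a : 𝒪) (i : Fin n), c' i * a = ∑ k, ι (A a i k) * c' k)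
    (hinj : Function.Injective fun (x : 𝒪) (i : Fin n) => t₀ (c' i * x))
    (Φ : 𝒪 ≃+ (Fin n → R)) (hΦA : ∀ a b : 𝒪, Φ (a * b) = (A a).mulVec (Φ b))
    (e : (Fin n → PowerSeries R) ≃+ PowerSeries 𝒪)
    (he : ∀ (r : PowerSeries R) (t : Fin n → PowerSeries R), e (r • t) = PowerSeries.map ι r * e t)
    (hA : ∀ (a : 𝒪) (t : Fin n → PowerSeries R),
      e (fun i => ∑ j, (PowerSeries.C (A a i j) : PowerSeries R) * t j) = (PowerSeries.C a : PowerSeries 𝒪) * e t) :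
    ∃ (ν : 𝒪) (W : PowerSeries 𝒪), ν ≠ 0 ∧ IsUnit W ∧
      ∀ x : 𝒪, e (fun i => (PowerSeries.C (t₀ (c' i * x)) : PowerSeries R)) = (PowerSeries.C (x * ν) : PowerSeries 𝒪) * W :=
  ⟨_, _, nu_ne_zero_of_injective t₀ c' hinj Φ, isUnit_apply_constCoords_one ι A Φ hΦA e he hA,
    apply_coords_eq_of_frame ι A t₀ ht₀ c' hfr Φ hΦA e hA⟩

/-- **(V3) CONVERSE: the recombination identity FORCES FRAME.** If for some `ν` the identity of (V1) holds for all `x`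
(`t₀` `R`-linear and nondegenerate), then `c'` is a FRAME.  So FRAME is not a convenience: it is equivalent to the
recombination step of the (i)-half road. [cite: Kato2004Asterisque, §13.8 (pp. 228–229)] -/
theorem frame_of_apply_coords_eq (ι : R →+* 𝒪) (A : 𝒪 →+* Matrix (Fin n) (Fin n) R) (t₀ : 𝒪 →+ R)
    (ht₀ : ∀ (c : R) (x : 𝒪), t₀ (ι c * x) = c * t₀ x) (hnd : ∀ y : 𝒪, (∀ x : 𝒪, t₀ (y * x) = 0) → y = 0)
    (c' : Fin n → 𝒪) (Φ : 𝒪 ≃+ (Fin n → R)) (hΦA : ∀ a b : 𝒪, Φ (a * b) = (A a).mulVec (Φ b))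
    (e : (Fin n → PowerSeries R) ≃+ PowerSeries 𝒪)
    (hA : ∀ (a : 𝒪) (t : Fin n → PowerSeries R),
      e (fun i => ∑ j, (PowerSeries.C (A a i j) : PowerSeries R) * t j) = (PowerSeries.C a : PowerSeries 𝒪) * e t)
    (ν : 𝒪)
    (hV : ∀ x : 𝒪, e (fun i => (PowerSeries.C (t₀ (c' i * x)) : PowerSeries R)) =
      (PowerSeries.C (x * ν) : PowerSeries 𝒪) * e fun i => (PowerSeries.C (Φ 1 i) : PowerSeries R))
    (a : 𝒪) (i : Fin n) :
    c' i * a = ∑ k, ι (A a i k) * c' k := by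
  refine frame_of_recombination_eq_mul ι A t₀ ht₀ hnd c' Φ hΦA ν (fun x => ?_) a i
  apply Φ.injective
  rw [AddEquiv.apply_symm_apply]
  have h := hV x
  rw [← apply_constCoords_mul A Φ hΦA e hA] at h
  simp only [mul_one] at h
  have h2 := congrFun (e.injective h)
  funext j
  have h3 := congrArg PowerSeries.constantCoeff (h2 j)
  simpa using h3

end Recombination

end Summit.BirchSwinnertonDyer.BirchSwinnertonDyer.Cruxes.ResidualThetaCountLowerPureAtTwo.SideaK1G28
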